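import Summits.ValiantsHypothesis.ValiantsHypothesis.Theorems.FifoMatchingNNDivisionHardConePricingAntitone

/-!
# CONE PRICING on the zonotope chapter of COR-VIRTUAL (crux `NNDivisionHard`, stmt-ValiantsHypothesis-21181) — part 3/5 — §12: the corona cone ITSELF is cheap (LOCALITY WALL)

Theorems-side port (val-port-1 g3, presser; declaration texts VERBATIM, one-line docstrings added where the gate lint wants them) of val-idea-44
g0's author-staged transplant `FifoMatchingNNDivisionHardConePricing.lean` (sha16 51fc894432d3ede5) of the crux workfile
`Cruxes/NNDivisionHard/ConePricing44.lean` rev 10 @0a2b2fead3a1 (W5-R2; critic of record val-idea-crit-9 g1: WAVE-5 LIST row (6) KEEP §G(3)+(4),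
ADDENDUM A4 SIG-FIRST GO 2026-08-28T22:04:39Z), split by the 400-line cap into five modules: `…ConePricing` (§2–§8) → `…Antitone` (§9–§11, §13)
→ `…Corona` (§12); `…ConePricing` → `…BalancedFaceZones` (§14, zones) → `…BalancedFace` (§14 theorem, §14b).  Statement-free (δ-unfolded `Prop`s).

* §12 `coronaCone_hasEF : HasEFOfSize (coronaCone h) (2h²+h)` — an explicit EF (the LP dual of §10); tangent-cone pricing is provably
  powerless on the unrestricted corona zonotope.

HONEST LABEL: helper rows for an OPEN crux (21181 `NNDivisionHard` OPEN; COR-VIRTUAL / `CovZonoHard` OPEN); nothing here is a summit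
statement; VP ≠ VNP is NOT proved.
-/

set_option autoImplicit false
-- the mandated summit-side namespace repeats a component by design (single-problem summit)
set_option linter.dupNamespace false

noncomputable section
open Matrix Finset
open scoped Pointwise

namespace Summit.ValiantsHypothesis.ValiantsHypothesis.Theorems.FifoMatching

namespace ConePricing

open Literature.Barriers.PneNP (HasEFOfSize)
open Literature.Combinatorics.Optimization (corPolytopeGraph corVec)

variable {h : ℕ}

/-! ## 12. The corona cone ITSELF is cheap: an explicit EF of size `2h² + h` (the LP dual of §10: `x_pq = (d_pq + d_qp)/2 + [p=q]·ρ_p`,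
`0 ≤ d_pq ≤ 2ρ_p`, `ρ_p ≥ 0`). -/

section coronaEF

/-- the row bracket of an antitone `W` with ALL positive parts is nonpositive. -/
theorem antitone_row_max_le {W : Fin h × Fin h → ℝ} (hW : W ∈ antitoneCone h) (x : Fin h) :
    W (x, x) + 2 * ∑ t, max (W (x, t)) 0 ≤ 0 := by
  classical
  have hdiag : W (x, x) ≤ 0 := by simpa using hW.2 x ∅ (by simp)
  have hsum : ∑ t, max (W (x, t)) 0 = ∑ t ∈ Finset.univ.filter (fun t => 0 < W (x, t)), W (x, t) := by
    rw [Finset.sum_filter]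
    exact Finset.sum_congr rfl fun t _ => max_zero_eq_ite _
  have hx : x ∉ Finset.univ.filter (fun t => 0 < W (x, t)) := by simp [not_lt.mpr hdiag]
  have := hW.2 x _ hx
  linarith [hsum]

/-- `u_{A,B}(p) = 𝟙[p ∈ (A∪B)∖B]` and `b_B(p) = 𝟙[p ∈ B]` as reals. -/
def uu (AB : Finset (Fin h) × Finset (Fin h)) (p : Fin h) : ℝ := chi (ind (AB.1 ∪ AB.2)) p - chi (ind AB.2) p
/-- indicator vector of the base block `B` of a pair `(A, B)`. -/
def bb (AB : Finset (Fin h) × Finset (Fin h)) (p : Fin h) : ℝ := chi (ind AB.2) p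

/-- `χ_b(p)·χ_b(p) = χ_b(p)`. -/
theorem chi_mul_self {m : ℕ} (b : Fin m → Bool) (p : Fin m) : chi b p * chi b p = chi b p := by
  unfold chi; split_ifs <;> simp

/-- entrywise formula for the corona kernel of `(A, B)` in terms of `uu` and `bb`. -/
theorem coronaKernel_apply' (AB : Finset (Fin h) × Finset (Fin h)) (p q : Fin h) :
    coronaKernel AB.1 AB.2 (p, q) = uu AB p * uu AB q + uu AB p * bb AB q + uu AB q * bb AB p := by
  simp only [coronaKernel, Pi.sub_apply, corVec_top_apply, uu, bb]
  ring

/-- the diagonal of the corona kernel of `(A, B)` is `uu`. -/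
theorem coronaKernel_diag (AB : Finset (Fin h) × Finset (Fin h)) (p : Fin h) :
    coronaKernel AB.1 AB.2 (p, p) = uu AB p := by
  simp only [coronaKernel, Pi.sub_apply, corVec_top_apply, chi_mul_self, uu]

/-- the `0/1` case analysis of `uu` and `bb` at a point, with `uu + 2·bb ≤ 2`. -/
theorem uu_cases (AB : Finset (Fin h) × Finset (Fin h)) (p : Fin h) :
    (uu AB p = 0 ∨ uu AB p = 1) ∧ (bb AB p = 0 ∨ bb AB p = 1) ∧ uu AB p + 2 * bb AB p ≤ 2 := by
  simp only [uu, bb, chi_ind, Finset.mem_union]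
  by_cases h2 : p ∈ AB.2 <;> by_cases h1 : p ∈ AB.1 <;> simp [h1, h2]

/-- `0 ≤ uu`. -/
theorem uu_nonneg (AB : Finset (Fin h) × Finset (Fin h)) (p : Fin h) : 0 ≤ uu AB p := by
  rcases (uu_cases AB p).1 with h0 | h1
  · rw [h0]
  · rw [h1]; exact zero_le_one

/-- `0 ≤ bb`. -/
theorem bb_nonneg (AB : Finset (Fin h) × Finset (Fin h)) (p : Fin h) : 0 ≤ bb AB p := by
  rcases (uu_cases AB p).2.1 with h0 | h1
  · rw [h0]
  · rw [h1]; exact zero_le_one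

/-- the dual slack matrices.  Slack variables `(d, e, ρ)` indexed by `P ⊕ (P ⊕ Fin h)`; rows `P ⊕ P`:
row₁ `(p,q)`: `x_pq − (d_pq + d_qp)/2 − [p = q]·ρ_p = 0`; row₂ `(p,q)`: `d_pq + e_pq − 2ρ_p = 0`. -/
def Dhalf (h : ℕ) : Matrix (Fin h × Fin h) (Fin h × Fin h) ℝ :=
  Matrix.of fun r c => -((if c = r then (1:ℝ) / 2 else 0) + (if c = (r.2, r.1) then 1 / 2 else 0))

/-- selector matrix: row `(p, p)` carries `−1` in column `p`, all other rows vanish. -/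
def DiagSel (h : ℕ) : Matrix (Fin h × Fin h) (Fin h) ℝ := Matrix.of fun r p => if r.1 = p ∧ r.2 = p then (-1:ℝ) else 0

/-- selector matrix: row `r` carries `−2` in column `r.1`. -/
def RowSel2 (h : ℕ) : Matrix (Fin h × Fin h) (Fin h) ℝ := Matrix.of fun r p => if r.1 = p then (-2:ℝ) else 0

/-- the `E` matrix of the slack-form EF of the corona cone. -/
def corE (h : ℕ) : Matrix ((Fin h × Fin h) ⊕ (Fin h × Fin h)) (Fin h × Fin h) ℝ := Matrix.fromRows 1 0

/-- the `F` matrix of the slack-form EF of the corona cone. -/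
def corF (h : ℕ) :
    Matrix ((Fin h × Fin h) ⊕ (Fin h × Fin h)) ((Fin h × Fin h) ⊕ ((Fin h × Fin h) ⊕ Fin h)) ℝ :=
  Matrix.fromRows (Matrix.fromCols (Dhalf h) (Matrix.fromCols 0 (DiagSel h)))
    (Matrix.fromCols 1 (Matrix.fromCols 1 (RowSel2 h)))

/-- row `r` of `Dhalf h *ᵥ d` is `−(d r + d (r.2, r.1))/2`. -/
theorem Dhalf_mulVec_apply (d : Fin h × Fin h → ℝ) (r : Fin h × Fin h) :
    (Dhalf h *ᵥ d) r = -((d r + d (r.2, r.1)) / 2) := by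
  classical
  simp [Dhalf, Matrix.mulVec, dotProduct, add_mul, Finset.sum_add_distrib, ite_mul, Finset.sum_ite_eq',
    Finset.sum_neg_distrib]
  ring

/-- row `r` of `DiagSel h *ᵥ ρ` is `−ρ r.1` on the diagonal and `0` off it. -/
theorem DiagSel_mulVec_apply (ρ : Fin h → ℝ) (r : Fin h × Fin h) :
    (DiagSel h *ᵥ ρ) r = -(if r.2 = r.1 then ρ r.1 else 0) := by
  classical
  simp only [DiagSel, Matrix.mulVec, dotProduct, Matrix.of_apply]
  rw [Finset.sum_eq_single r.1 (fun p _ hp => by simp [Ne.symm hp]) (by simp)]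
  by_cases h21 : r.2 = r.1 <;> simp [h21]

/-- row `r` of `RowSel2 h *ᵥ ρ` is `−2·ρ r.1`. -/
theorem RowSel2_mulVec_apply (ρ : Fin h → ℝ) (r : Fin h × Fin h) : (RowSel2 h *ᵥ ρ) r = -(2 * ρ r.1) := by
  classical
  simp [RowSel2, Matrix.mulVec, dotProduct, ite_mul, Finset.sum_ite_eq]

/-- first block row of `corE h *ᵥ x + corF h *ᵥ y`. -/
theorem cor_row₁ (x : Fin h × Fin h → ℝ) (y : (Fin h × Fin h) ⊕ ((Fin h × Fin h) ⊕ Fin h) → ℝ) (r : Fin h × Fin h) :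
    (corE h *ᵥ x + corF h *ᵥ y) (Sum.inl r)
      = x r - (y (Sum.inl r) + y (Sum.inl (r.2, r.1))) / 2 - (if r.2 = r.1 then y (Sum.inr (Sum.inr r.1)) else 0) := by
  simp [corE, corF, Matrix.fromRows_mulVec, Matrix.fromBlocks_mulVec, Dhalf_mulVec_apply, DiagSel_mulVec_apply]
  ring

/-- second block row of `corE h *ᵥ x + corF h *ᵥ y`. -/
theorem cor_row₂ (x : Fin h × Fin h → ℝ) (y : (Fin h × Fin h) ⊕ ((Fin h × Fin h) ⊕ Fin h) → ℝ) (r : Fin h × Fin h) :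
    (corE h *ᵥ x + corF h *ᵥ y) (Sum.inr r) = y (Sum.inl r) + y (Sum.inr (Sum.inl r)) - 2 * y (Sum.inr (Sum.inr r.1)) := by
  simp [corE, corF, Matrix.fromRows_mulVec, Matrix.fromBlocks_mulVec, RowSel2_mulVec_apply]
  ring


/-- ★ the corona cone IS the projection of the explicit dual system. -/
theorem coronaCone_eq_dualSystem (h : ℕ) :
    coronaCone h = {x | ∃ y : (Fin h × Fin h) ⊕ ((Fin h × Fin h) ⊕ Fin h) → ℝ,
      (∀ j, 0 ≤ y j) ∧ corE h *ᵥ x + corF h *ᵥ y = 0} := by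
  classical
  ext x
  constructor
  · rintro ⟨μ, hμ, hbad, rfl⟩
    let ρ : Fin h → ℝ := fun p => ∑ AB, μ AB * uu AB p
    let d : Fin h × Fin h → ℝ := fun c =>
      if c.2 = c.1 then 0 else ∑ AB, μ AB * (uu AB c.1 * uu AB c.2 + 2 * (uu AB c.1 * bb AB c.2))
    have hρ : ∀ p, 0 ≤ ρ p := fun p => Finset.sum_nonneg fun AB _ => mul_nonneg (hμ AB) (uu_nonneg AB p)
    have hd : ∀ c, 0 ≤ d c := fun c => by
      by_cases hc : c.2 = c.1
      · simp only [d, hc, if_true]; exact le_rfl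
      · simp only [d, hc, if_false]
        exact Finset.sum_nonneg fun AB _ => mul_nonneg (hμ AB)
          (by nlinarith [uu_nonneg AB c.1, uu_nonneg AB c.2, bb_nonneg AB c.2, mul_nonneg (uu_nonneg AB c.1) (uu_nonneg AB c.2),
            mul_nonneg (uu_nonneg AB c.1) (bb_nonneg AB c.2)])
    have hdle : ∀ c, d c ≤ 2 * ρ c.1 := fun c => by
      by_cases hc : c.2 = c.1
      · simp only [d, hc, if_true]; exact mul_nonneg zero_le_two (hρ c.1)
      · simp only [d, hc, if_false, ρ]
        rw [Finset.mul_sum]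
        refine Finset.sum_le_sum fun AB _ => ?_
        have h2 := (uu_cases AB c.2).2.2
        nlinarith [hμ AB, uu_nonneg AB c.1, mul_nonneg (hμ AB) (uu_nonneg AB c.1)]
    refine ⟨Sum.elim d (Sum.elim (fun c => 2 * ρ c.1 - d c) ρ), ?_, ?_⟩
    · rintro (c | c | p)
      · exact hd c
      · show 0 ≤ 2 * ρ c.1 - d c
        linarith [hdle c]
      · exact hρ p
    · funext i
      rcases i with r | r
      · rw [cor_row₁, Finset.sum_apply]
        simp only [Sum.elim_inl, Sum.elim_inr, Pi.zero_apply, Pi.smul_apply, smul_eq_mul]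
        obtain ⟨p, q⟩ := r
        simp only
        by_cases hpq : q = p
        · subst hpq
          simp [d, ρ, coronaKernel_diag]
        · have hqp : ¬ p = q := fun h' => hpq h'.symm
          simp only [d, hpq, hqp, if_false, sub_zero]
          rw [← Finset.sum_add_distrib, Finset.sum_div, ← Finset.sum_sub_distrib]
          refine Finset.sum_eq_zero fun AB _ => ?_
          rw [coronaKernel_apply']
          ring
      · rw [cor_row₂]
        simp only [Sum.elim_inl, Sum.elim_inr, Pi.zero_apply]
        ring
  · rintro ⟨y, hy, hsys⟩
    have e₁ : ∀ r : Fin h × Fin h, x r = (y (Sum.inl r) + y (Sum.inl (r.2, r.1))) / 2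
        + (if r.2 = r.1 then y (Sum.inr (Sum.inr r.1)) else 0) := fun r => by
      have := congrFun hsys (Sum.inl r)
      rw [cor_row₁] at this
      simp only [Pi.zero_apply] at this
      linarith
    have e₂ : ∀ r : Fin h × Fin h, y (Sum.inl r) ≤ 2 * y (Sum.inr (Sum.inr r.1)) := fun r => by
      have := congrFun hsys (Sum.inr r)
      rw [cor_row₂] at this
      simp only [Pi.zero_apply] at this
      linarith [hy (Sum.inr (Sum.inl r))]
    have hxsym : ∀ p q, x (p, q) = x (q, p) := fun p q => by
      rw [e₁ (p, q), e₁ (q, p)]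
      simp only
      by_cases hpq : q = p
      · subst hpq; simp
      · have hqp : ¬ p = q := fun h' => hpq h'.symm
        simp only [hpq, hqp, if_false]
        ring
    refine mem_coronaCone_of_polar hxsym fun W hW => ?_
    have hWsym := hW.1
    set ρ : Fin h → ℝ := fun p => y (Sum.inr (Sum.inr p)) with hρdef
    set d : Fin h × Fin h → ℝ := fun c => y (Sum.inl c) with hddef
    have hx' : ∀ c : Fin h × Fin h, x c = (d c + d (c.2, c.1)) / 2 + (if c.2 = c.1 then ρ c.1 else 0) := fun c => e₁ c
    have hswap : ∑ c : Fin h × Fin h, W c * d (c.2, c.1) = ∑ c : Fin h × Fin h, W c * d c := by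
      calc ∑ c : Fin h × Fin h, W c * d (c.2, c.1)
          = ∑ c : Fin h × Fin h, (fun c : Fin h × Fin h => W (c.2, c.1) * d c) (Equiv.prodComm (Fin h) (Fin h) c) := rfl
        _ = ∑ c : Fin h × Fin h, W (c.2, c.1) * d c :=
          Equiv.sum_comp (Equiv.prodComm (Fin h) (Fin h)) (fun c : Fin h × Fin h => W (c.2, c.1) * d c)
        _ = ∑ c : Fin h × Fin h, W c * d c := Fintype.sum_congr _ _ fun c => by rw [hWsym c.2 c.1]
    have hdiag : ∑ c : Fin h × Fin h, W c * (if c.2 = c.1 then ρ c.1 else 0) = ∑ p, W (p, p) * ρ p := by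
      rw [Fintype.sum_prod_type]
      refine Fintype.sum_congr _ _ fun p => ?_
      rw [Finset.sum_eq_single p (fun q _ hq => by simp [hq]) (by simp)]
      simp
    have step1 : ∑ c, W c * x c = ∑ c : Fin h × Fin h, W c * d c + ∑ p, W (p, p) * ρ p := by
      calc ∑ c, W c * x c
          = ∑ c : Fin h × Fin h, (W c * d c / 2 + W c * d (c.2, c.1) / 2 + W c * (if c.2 = c.1 then ρ c.1 else 0)) :=
            Fintype.sum_congr _ _ fun c => by rw [hx' c]; ring
        _ = (∑ c : Fin h × Fin h, W c * d c) / 2 + (∑ c : Fin h × Fin h, W c * d (c.2, c.1)) / 2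
              + ∑ c : Fin h × Fin h, W c * (if c.2 = c.1 then ρ c.1 else 0) := by
            rw [Finset.sum_add_distrib, Finset.sum_add_distrib, Finset.sum_div, Finset.sum_div]
        _ = ∑ c : Fin h × Fin h, W c * d c + ∑ p, W (p, p) * ρ p := by rw [hswap, hdiag]; ring
    rw [step1, Fintype.sum_prod_type, ← Finset.sum_add_distrib]
    refine Finset.sum_nonpos fun p _ => ?_
    have hρp : 0 ≤ ρ p := hy _
    have hrow : ∑ q, W (p, q) * d (p, q) ≤ 2 * ρ p * ∑ q, max (W (p, q)) 0 := by
      rw [Finset.mul_sum]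
      refine Finset.sum_le_sum fun q _ => ?_
      have hdq : 0 ≤ d (p, q) := hy _
      have hdle : d (p, q) ≤ 2 * ρ p := e₂ (p, q)
      calc W (p, q) * d (p, q) ≤ max (W (p, q)) 0 * d (p, q) := mul_le_mul_of_nonneg_right (le_max_left _ _) hdq
        _ ≤ max (W (p, q)) 0 * (2 * ρ p) := mul_le_mul_of_nonneg_left hdle (le_max_right _ _)
        _ = 2 * ρ p * max (W (p, q)) 0 := by ring
    have hbr := antitone_row_max_le hW p
    nlinarith [hrow, hbr, hρp, mul_nonpos_iff.mpr (Or.inl ⟨hρp, hbr⟩)]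

/-- ★ PROVED: the corona cone has a slack-form EF of size `h² + (h² + h) = 2h² + h`. -/
theorem coronaCone_hasEF (h : ℕ) : HasEFOfSize (coronaCone h) (2 * h * h + h) := by
  classical
  have h0 := Literature.Barriers.PneNP.hasEFOfSize_of_system (ι := Fin h × Fin h) (corE h) (corF h) 0
  rw [← coronaCone_eq_dualSystem] at h0
  simp only [Fintype.card_sum, Fintype.card_prod, Fintype.card_fin] at h0
  convert h0 using 1
  ring



end coronaEF

end ConePricing

end Summit.ValiantsHypothesis.ValiantsHypothesis.Theorems.FifoMatching

end
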